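import Literature.NumberTheory.K2Lit.SiegelStandardSections
import HarnessLib

/-!
# K2Lit — the STANDARD (flat) extension of a Siegel section at `s₀` to a family `f_s`, along an Iwasawa datum (DEFS leaf O42.3d)

Topic `NumberTheory/K2Lit` (Track B, build stream 29; item of record hLiu418 = stmt-HodgeConjecture-24832; steward of socket #42R
`sig_K2LiuEisensteinResidueIsThetaIntegral`: `hodgecm-mathlib-K2Liu-p02` (g2), REPORT-FIRST §3, 2026-09-04).  Definitions and proved lemmas only:
**no `sorry`, no named fact, no instance, no notation.**

Every socket of the K2_Liu road quantifies over STANDARD families (★ `IsStandardSectionFamily 𝒦 χ f`: holomorphic + `K`-finite + FLAT), while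
the Siegel–Weil machine produces sections AT ONE POINT `s₀` (★ `SiegelWeilSectionLine.swSection` at `s₀ = (1 − n)/2`; the first-term identity
reads sections at `s₀ = ½`).  The bridge is the standard extension [KudlaRallis1994 §1; Tan1999 §1; HarrisKudlaSweet1996 (1.17)]: for
`h = p k` (Iwasawa, ★ `IwasawaDatum.iwasawa`), `f_s(h) := |det_Δ p|_{𝔸}^{s − s₀} · φ(h)`.  Well-definedness needs `|det_Δ|` to be `1` on
`P_Δ(𝔸) ∩ K` — TRUE for the maximal compact `K = ∏_v K_v` (a continuous homomorphism from a compact group to `ℝ_{>0}`), but the tree's ★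
`IwasawaDatum` is an INTERFACE without that clause, so this leaf carries it as the displayed hypothesis `IwasawaDatum.IsDeltaUnimodular 𝒦`
(to be discharged once for the datum of record ★ `sig_K2LiuIwasawaDatumNonempty`'s witness; sized S–M: continuity of `p ↦ |det_Δ p|` on `P_Δ(𝔸)`).

* `IwasawaDatum.pPart 𝒦 h`, `kPart 𝒦 h` — a CHOSEN Iwasawa decomposition `h = pPart h · kPart h` (`pPart_isSiegelDelta`, `kPart_mem`,
  `pPart_mul_kPart`); `IwasawaDatum.IsDeltaUnimodular 𝒦` — `|det_Δ k|^{1/2} = 1` for `k ∈ K ∩ P_Δ(𝔸)`;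
* `modDelta_pPart_eq` — under unimodularity `|det_Δ ·|^{1/2}` of ANY Iwasawa `P`-part of `h` is the same (`h = p k ⇒ modDelta p = modDelta (pPart h)`),
  hence `modDelta_pPart_delta_mul` (`pPart (p′ h)` has modulus `modDelta p′ · modDelta (pPart h)`), `modDelta_pPart_of_mem_K` (`= 1` on `K`),
  `modDelta_pPart_mul_K` (right `K`-invariance);
* `stdExtension 𝒦 s₀ φ s h := (modDelta (pPart h))^{2(s − s₀)} · φ h` and its theorems: `stdExtension_self` (`f_{s₀} = φ`, NO hypothesis),
  `differentiable_stdExtension` (entire in `s`), and under unimodularity `isSiegelDeltaSection_stdExtension` (`f_s ∈ I(s, χ)` when `φ ∈ I(s₀, χ)`),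
  `stdExtension_apply_of_mem_K` (flat: `f_s|_K = φ|_K`), `isKFinite_stdExtension` (`K`-finite when `φ` is), assembled as
  **`isStandardSectionFamily_stdExtension`**.

HONEST LABEL: HC_CM is proved only modulo the 7 printed citations (2 remaining named inputs: hLiu418 = stmt-HodgeConjecture-24832, h413 =
stmt-HodgeConjecture-24833) until rung 0 closes; this leaf asserts nothing printed.

References: [KudlaRallis1994] S. Kudla, S. Rallis, Ann. of Math. 140 (1994) §1 (standard sections `Φ(s)`); [Tan1999] V. Tan, Canad. J. Math. 51
(1999) §1; [HarrisKudlaSweet1996] §1 (1.15)–(1.17); [GanQiuTakeda2014] §1.10; [Liu2021] Lem. B.10 p. 102.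
-/

set_option autoImplicit false

noncomputable section

open NumberField IsDedekindDomain
open scoped Matrix

namespace Literature.NumberTheory.K2Lit.SiegelDoubled

open Literature.NumberTheory.Automorphic Literature.NumberTheory.GaloisRepresentations
open Literature.NumberTheory.GelbartRogawski1991 Literature.NumberTheory.GelbartRogawski1991.GRConstruction

variable {L : Type} [Field L] [NumberField L] [IsCMField L]
variable {N M n : ℕ} {e : Fin N × Fin M ≃ Fin n}
  {dV : Fin N → L} {hdV : ∀ i, IsCMField.complexConj L (dV i) = dV i}
  {dW : Fin M → L} {hdW : ∀ i, IsCMField.complexConj L (dW i) = dW i}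

/-! ## 1. A chosen Iwasawa decomposition and the unimodularity clause -/

namespace IwasawaDatum

variable (𝒦 : IwasawaDatum L e dV hdV dW hdW)

/-- the chosen `P_Δ(𝔸)`-part of `h` in an Iwasawa decomposition `h = p k`. [cite: Tan1999, §1] -/
def pPart (h : HA L e dV hdV dW hdW) : HA L e dV hdV dW hdW :=
  Classical.choose (𝒦.iwasawa h)

/-- the chosen `K`-part of `h`. [cite: Tan1999, §1] -/
def kPart (h : HA L e dV hdV dW hdW) : HA L e dV hdV dW hdW :=
  Classical.choose (Classical.choose_spec (𝒦.iwasawa h))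

/-- `pPart h ∈ P_Δ(𝔸)`. [cite: Tan1999, §1] -/
theorem pPart_isSiegelDelta (h : HA L e dV hdV dW hdW) : IsSiegelDelta L e dV hdV dW hdW (𝒦.pPart h) :=
  (Classical.choose_spec (Classical.choose_spec (𝒦.iwasawa h))).1

/-- `kPart h ∈ K`. [cite: Tan1999, §1] -/
theorem kPart_mem (h : HA L e dV hdV dW hdW) : 𝒦.kPart h ∈ 𝒦.K :=
  (Classical.choose_spec (Classical.choose_spec (𝒦.iwasawa h))).2.1

/-- `h = pPart h · kPart h`. [cite: Tan1999, §1] -/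
theorem pPart_mul_kPart (h : HA L e dV hdV dW hdW) : 𝒦.pPart h * 𝒦.kPart h = h :=
  (Classical.choose_spec (Classical.choose_spec (𝒦.iwasawa h))).2.2.symm

/-- **unimodularity of `K` along `Δ`**: `|det_Δ k|^{1/2} = 1` for every `k ∈ K ∩ P_Δ(𝔸)`.  True for the maximal compact datum of record
(continuous homomorphism from a compact group into `ℝ_{>0}`); displayed as a hypothesis of the flat extension because ★ `IwasawaDatum` is an
interface. [cite: Tan1999, §1] [cite: HarrisKudlaSweet1996, (1.15)] -/
def IsDeltaUnimodular : Prop :=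
  ∀ k : HA L e dV hdV dW hdW, k ∈ 𝒦.K → IsSiegelDelta L e dV hdV dW hdW k → modDelta L e dV hdV dW hdW k = 1

variable {𝒦}

/-- **the modulus of an Iwasawa `P`-part is well defined**: if `h = p k` with `p ∈ P_Δ(𝔸)`, `k ∈ K`, then `|det_Δ p|^{1/2} = |det_Δ (pPart h)|^{1/2}`
(the two `P`-parts differ by an element of `K ∩ P_Δ(𝔸)`). [cite: Tan1999, §1] -/
theorem modDelta_pPart_eq (hK : 𝒦.IsDeltaUnimodular) {h p k : HA L e dV hdV dW hdW} (hp : IsSiegelDelta L e dV hdV dW hdW p)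
    (hk : k ∈ 𝒦.K) (hh : h = p * k) : modDelta L e dV hdV dW hdW (𝒦.pPart h) = modDelta L e dV hdV dW hdW p := by
  -- `m := p⁻¹ · pPart h = k · (kPart h)⁻¹ ∈ K ∩ P_Δ(𝔸)`
  have hdec := 𝒦.pPart_mul_kPart h
  have hm_eq : p⁻¹ * 𝒦.pPart h = k * (𝒦.kPart h)⁻¹ := by
    have e1 : 𝒦.pPart h = p * k * (𝒦.kPart h)⁻¹ := by rw [eq_mul_inv_iff_mul_eq, hdec, hh]
    rw [e1, mul_assoc p, inv_mul_cancel_left]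
  have hmK : p⁻¹ * 𝒦.pPart h ∈ 𝒦.K := by
    rw [hm_eq]; exact 𝒦.K.mul_mem hk (𝒦.K.inv_mem (𝒦.kPart_mem h))
  have hmP : IsSiegelDelta L e dV hdV dW hdW (p⁻¹ * 𝒦.pPart h) :=
    isSiegelDelta_mul L e dV hdV dW hdW (isSiegelDelta_inv L e dV hdV dW hdW hp) (𝒦.pPart_isSiegelDelta h)
  have h1 : 𝒦.pPart h = p * (p⁻¹ * 𝒦.pPart h) := by rw [mul_inv_cancel_left]
  rw [h1, modDelta_mul L e dV hdV dW hdW hp hmP, hK _ hmK hmP, mul_one]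

/-- `|det_Δ (pPart (p′ · h))|^{1/2} = |det_Δ p′|^{1/2} · |det_Δ (pPart h)|^{1/2}` for `p′ ∈ P_Δ(𝔸)`. [cite: Tan1999, §1] -/
theorem modDelta_pPart_delta_mul (hK : 𝒦.IsDeltaUnimodular) {p' : HA L e dV hdV dW hdW} (hp' : IsSiegelDelta L e dV hdV dW hdW p')
    (h : HA L e dV hdV dW hdW) :
    modDelta L e dV hdV dW hdW (𝒦.pPart (p' * h)) = modDelta L e dV hdV dW hdW p' * modDelta L e dV hdV dW hdW (𝒦.pPart h) := by
  rw [modDelta_pPart_eq hK (isSiegelDelta_mul L e dV hdV dW hdW hp' (𝒦.pPart_isSiegelDelta h)) (𝒦.kPart_mem h)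
      (by rw [mul_assoc, 𝒦.pPart_mul_kPart]),
    modDelta_mul L e dV hdV dW hdW hp' (𝒦.pPart_isSiegelDelta h)]

/-- `|det_Δ (pPart k)|^{1/2} = 1` for `k ∈ K` (decomposition `k = 1 · k`). [cite: Tan1999, §1] -/
theorem modDelta_pPart_of_mem_K (hK : 𝒦.IsDeltaUnimodular) {k : HA L e dV hdV dW hdW} (hk : k ∈ 𝒦.K) :
    modDelta L e dV hdV dW hdW (𝒦.pPart k) = 1 := by
  rw [modDelta_pPart_eq hK (isSiegelDelta_one' L e dV hdV dW hdW) hk (one_mul k).symm, modDelta_one']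

/-- `|det_Δ (pPart (h · k))|^{1/2} = |det_Δ (pPart h)|^{1/2}` for `k ∈ K` (right `K`-invariance). [cite: Tan1999, §1] -/
theorem modDelta_pPart_mul_K (hK : 𝒦.IsDeltaUnimodular) (h : HA L e dV hdV dW hdW) {k : HA L e dV hdV dW hdW} (hk : k ∈ 𝒦.K) :
    modDelta L e dV hdV dW hdW (𝒦.pPart (h * k)) = modDelta L e dV hdV dW hdW (𝒦.pPart h) :=
  modDelta_pPart_eq hK (𝒦.pPart_isSiegelDelta h) (𝒦.K.mul_mem (𝒦.kPart_mem h) hk)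
    (by rw [← mul_assoc, 𝒦.pPart_mul_kPart])

end IwasawaDatum

/-! ## 2. The standard extension `f_s(h) = |det_Δ p_h|^{s − s₀} · φ(h)` -/

/-- **The standard (flat) extension of `φ` from `s₀` along `𝒦`**: `f_s(h) := (|det_Δ (pPart h)|^{1/2})^{2(s − s₀)} · φ(h)` — at `s = s₀` it is `φ`,
and on `K` it is `φ|_K` for every `s`. [cite: KudlaRallis1994, §1] [cite: Tan1999, §1] [cite: HarrisKudlaSweet1996, (1.17)] -/
def stdExtension (𝒦 : IwasawaDatum L e dV hdV dW hdW) (s₀ : ℂ) (φ : HA L e dV hdV dW hdW → ℂ) (s : ℂ) (h : HA L e dV hdV dW hdW) : ℂ :=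
  ((modDelta L e dV hdV dW hdW (𝒦.pPart h) : ℝ) : ℂ) ^ (2 * (s - s₀)) * φ h

variable (𝒦 : IwasawaDatum L e dV hdV dW hdW) (s₀ : ℂ) (φ : HA L e dV hdV dW hdW → ℂ)

/-- `f_{s₀} = φ` (no hypothesis). [cite: KudlaRallis1994, §1] -/
@[simp] theorem stdExtension_self : stdExtension 𝒦 s₀ φ s₀ = φ := by
  funext h
  rw [stdExtension, sub_self, mul_zero, Complex.cpow_zero, one_mul]

/-- `s ↦ f_s(h)` is entire. [cite: Tan1999, §1] -/
theorem differentiable_stdExtension (h : HA L e dV hdV dW hdW) : Differentiable ℂ fun s => stdExtension 𝒦 s₀ φ s h := by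
  have hc : ((modDelta L e dV hdV dW hdW (𝒦.pPart h) : ℝ) : ℂ) ≠ 0 :=
    Complex.ofReal_ne_zero.2 (modDelta_pos L e dV hdV dW hdW _).ne'
  unfold stdExtension
  exact ((differentiable_id.sub_const s₀).const_mul (2 : ℂ)).const_cpow (Or.inl hc) |>.mul_const (φ h)

/-- `f_s` is linear in `φ`: additivity. [cite: KudlaRallis1994, §1] -/
theorem stdExtension_add (ψ : HA L e dV hdV dW hdW → ℂ) :
    stdExtension 𝒦 s₀ (φ + ψ) = stdExtension 𝒦 s₀ φ + stdExtension 𝒦 s₀ ψ := by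
  funext s h
  simp only [stdExtension, Pi.add_apply, mul_add]

/-- `f_s` is linear in `φ`: homogeneity. [cite: KudlaRallis1994, §1] -/
theorem stdExtension_smul (c : ℂ) : stdExtension 𝒦 s₀ (c • φ) = c • stdExtension 𝒦 s₀ φ := by
  funext s h
  simp only [stdExtension, Pi.smul_apply, smul_eq_mul]
  ring

variable {𝒦 s₀ φ}

/-- **Flatness**: on `K`, `f_s = φ` for every `s`. [cite: Tan1999, §1] [cite: HarrisKudlaSweet1996, (1.17)] -/
theorem stdExtension_apply_of_mem_K (hK : 𝒦.IsDeltaUnimodular) (s : ℂ) {k : HA L e dV hdV dW hdW} (hk : k ∈ 𝒦.K) :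
    stdExtension 𝒦 s₀ φ s k = φ k := by
  rw [stdExtension, IwasawaDatum.modDelta_pPart_of_mem_K hK hk, Complex.ofReal_one, Complex.one_cpow, one_mul]

/-- right `K`-translation commutes with the extension: `f_s(h k) = |det_Δ p_h|^{s−s₀} · φ(h k)`. [cite: Tan1999, §1] -/
theorem stdExtension_mul_K (hK : 𝒦.IsDeltaUnimodular) (s : ℂ) (h : HA L e dV hdV dW hdW) {k : HA L e dV hdV dW hdW} (hk : k ∈ 𝒦.K) :
    stdExtension 𝒦 s₀ φ s (h * k) =
      ((modDelta L e dV hdV dW hdW (𝒦.pPart h) : ℝ) : ℂ) ^ (2 * (s - s₀)) * φ (h * k) := by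
  rw [stdExtension, IwasawaDatum.modDelta_pPart_mul_K hK h hk]

/-- **Section property**: if `φ ∈ I(s₀, χ)` then `f_s ∈ I(s, χ)` for every `s`
(`χ(det_Δ p)|det_Δ p|^{s₀+n/2} · |det_Δ p|^{s−s₀} = χ(det_Δ p)|det_Δ p|^{s+n/2}`). [cite: KudlaRallis1994, §1] [cite: Tan1999, §1] -/
theorem isSiegelDeltaSection_stdExtension (hK : 𝒦.IsDeltaUnimodular) {χ : HeckeCharacter L}
    (hφ : IsSiegelDeltaSection L e dV hdV dW hdW χ s₀ φ) (s : ℂ) :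
    IsSiegelDeltaSection L e dV hdV dW hdW χ s (stdExtension 𝒦 s₀ φ s) := by
  intro p hp h
  have hpos : 0 < modDelta L e dV hdV dW hdW p := modDelta_pos L e dV hdV dW hdW p
  have hpos' : 0 < modDelta L e dV hdV dW hdW (𝒦.pPart h) := modDelta_pos L e dV hdV dW hdW _
  have hne : ((modDelta L e dV hdV dW hdW p : ℝ) : ℂ) ≠ 0 := Complex.ofReal_ne_zero.2 hpos.ne'
  rw [stdExtension, stdExtension, IwasawaDatum.modDelta_pPart_delta_mul hK hp h, hφ p hp h, Complex.ofReal_mul,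
    Complex.mul_cpow_ofReal_nonneg hpos.le hpos'.le]
  unfold siegelDeltaCharacter
  have hexp : ((modDelta L e dV hdV dW hdW p : ℝ) : ℂ) ^ (2 * s + (n : ℂ)) =
      ((modDelta L e dV hdV dW hdW p : ℝ) : ℂ) ^ (2 * (s - s₀)) * ((modDelta L e dV hdV dW hdW p : ℝ) : ℂ) ^ (2 * s₀ + (n : ℂ)) := by
    rw [← Complex.cpow_add _ _ hne]; ring_nf
  rw [hexp]; ring

/-- **`K`-finiteness is preserved**: if `φ` is `K`-finite then so is `f_s` — the right `K`-translates of `f_s` lie in the image of the span of the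
right `K`-translates of `φ` under multiplication by the `K`-invariant modulus `h ↦ |det_Δ p_h|^{s−s₀}`. [cite: Tan1999, §1] [cite: HarrisKudlaSweet1996, (1.16)] -/
theorem isKFinite_stdExtension (hK : 𝒦.IsDeltaUnimodular) (hφK : IsKFinite 𝒦 φ) (s : ℂ) : IsKFinite 𝒦 (stdExtension 𝒦 s₀ φ s) := by
  -- the multiplication map `ψ ↦ (h ↦ M(h) ψ(h))`
  set Mul : (HA L e dV hdV dW hdW → ℂ) →ₗ[ℂ] (HA L e dV hdV dW hdW → ℂ) :=
    { toFun := fun ψ h => ((modDelta L e dV hdV dW hdW (𝒦.pPart h) : ℝ) : ℂ) ^ (2 * (s - s₀)) * ψ h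
      map_add' := fun ψ ψ' => funext fun h => by simp only [Pi.add_apply, mul_add]
      map_smul' := fun c ψ => funext fun h => by simp only [Pi.smul_apply, smul_eq_mul, RingHom.id_apply]; ring } with hMul
  have hle : rightTranslateSpan 𝒦 (stdExtension 𝒦 s₀ φ s) ≤ (rightTranslateSpan 𝒦 φ).map Mul := by
    refine Submodule.span_le.2 ?_
    rintro _ ⟨k, rfl⟩
    refine ⟨fun h => φ (h * (k : HA L e dV hdV dW hdW)), rightTranslate_mem_rightTranslateSpan 𝒦 φ k.2, funext fun h => ?_⟩
    simp only [hMul, LinearMap.coe_mk, AddHom.coe_mk]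
    exact (stdExtension_mul_K hK s h k.2).symm
  unfold IsKFinite at *
  haveI := hφK
  exact Submodule.finiteDimensional_of_le hle

/-- **THE STANDARD EXTENSION IS A STANDARD FAMILY**: for an Iwasawa datum `𝒦` unimodular along `Δ`, a `K`-finite Siegel section
`φ ∈ I(s₀, χ)` extends to the standard family `f_s = stdExtension 𝒦 s₀ φ s` (★ `IsStandardSectionFamily 𝒦 χ`): holomorphic, `K`-finite, flat, with
`f_{s₀} = φ` (`stdExtension_self`). [cite: KudlaRallis1994, §1] [cite: Tan1999, §1] [cite: HarrisKudlaSweet1996, (1.15)–(1.17)] -/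
theorem isStandardSectionFamily_stdExtension (hK : 𝒦.IsDeltaUnimodular) {χ : HeckeCharacter L}
    (hφ : IsSiegelDeltaSection L e dV hdV dW hdW χ s₀ φ) (hφK : IsKFinite 𝒦 φ) :
    IsStandardSectionFamily 𝒦 χ (stdExtension 𝒦 s₀ φ) :=
  ⟨⟨fun s => isSiegelDeltaSection_stdExtension hK hφ s, fun h => differentiable_stdExtension 𝒦 s₀ φ h⟩,
    fun s => isKFinite_stdExtension hK hφK s,
    fun k hk s s' => by rw [stdExtension_apply_of_mem_K hK s hk, stdExtension_apply_of_mem_K hK s' hk]⟩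

end Literature.NumberTheory.K2Lit.SiegelDoubled

end
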